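import Summits.CriticalPhenomena.SAWScalingLimit.Theorems.ShellCrossingBound.Negative.Forcing4Scale

/-!
# `ShellCrossingBound` — negative knowledge: forcing corridors (the uniform-threshold Aizenman–Burchard hypothesis is false for the critical SAW)

Part 5: the endpoint approximations `a_δ, b_δ` and `isEndpointApprox`; chains of crossing times by the intermediate value theorem (`exists_chain`); the crossing abscissae `u_j` and the values `ctr u_j = ±√u_j` (`ctr_useq_even/odd`).

Support file for crux `stmt-CriticalPhenomena-4728` (refuter `cdisprove`; work file
`Summits/CriticalPhenomena/SAWScalingLimit/Cruxes/ShellCrossingBound/Disproof.lean`; conclusion in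
`Negative/UniformThresholdFalse.lean`). Everything proved. [folklore]
-/

noncomputable section

open Set Filter Topology Metric MeasureTheory Complex
open scoped ENNReal Real
open Literature.Probability.RandomPlanarGeometry Literature.Probability.LatticeModels

namespace Summit.CriticalPhenomena.SAWScalingLimit.Theorems.ShellCrossingBound.Negative.Forcing

/-! ## E.3 The endpoint approximations -/

/-- First resolved column. [folklore] -/
def icol (δ : ℝ) : ℤ := ⌈xres δ / δ⌉

/-- `a_δ`: the spine point of the first resolved column (deep in the wiggly tail, `→ a = 0`). [folklore] -/
def aδ (δ : ℝ) : Site 2 := ![icol δ, jsp δ (icol δ)]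

/-- Last column but one. [folklore] -/
def ib (δ : ℝ) : ℤ := ⌊1 / δ⌋ - 1

/-- Lowest admissible level of column `ib δ`, plus one. [folklore] -/
def jb (δ : ℝ) : ℤ := ⌊(ctr (δ * ib δ) - sl * (δ * ib δ)) / δ⌋ + 1

/-- `b_δ`: near the lower right corner `b = 1 - i/4`. [folklore] -/
def bδ (δ : ℝ) : Site 2 := ![ib δ, jb δ]

section Endpoints

variable {δ : ℝ} (hδ : 0 < δ) (h0 : δ ≤ dmin 0)
include hδ h0

/-- A mesh below `dmin 0` is at most `1/128`. [folklore] -/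
theorem delta_small : δ ≤ 1 / 128 := by
  have hg := good_xres hδ h0
  have := hg.hsmall; have := xres_le_quarter δ
  simp only [sl] at *
  linarith

omit h0 in
/-- The first resolved column covers the resolution abscissa within one mesh. [folklore] -/
theorem icol_bounds : xres δ ≤ δ * (icol δ : ℝ) ∧ δ * (icol δ : ℝ) < xres δ + δ := by
  have h1 : xres δ / δ ≤ (icol δ : ℝ) := Int.le_ceil _
  have h2 : (icol δ : ℝ) < xres δ / δ + 1 := Int.ceil_lt_add_one _
  rw [div_le_iff₀ hδ] at h1
  have h2' : (icol δ : ℝ) * δ < (xres δ / δ + 1) * δ := mul_lt_mul_of_pos_right h2 hδ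
  rw [add_mul, div_mul_cancel₀ _ hδ.ne', one_mul] at h2'
  constructor <;> linarith

/-- `a_δ` lies in the room. [folklore] -/
theorem aδ_mem_RS : aδ δ ∈ RS δ (xres δ) := by
  have hg := good_xres hδ h0
  obtain ⟨h1, h2⟩ := icol_bounds hδ
  have hq := xres_le_quarter δ
  have hs := delta_small hδ h0
  refine ⟨spine_mem hg h1 (by linarith), by simpa [aδ] using h1⟩

omit h0 in
/-- The abscissa of `b_δ` is within two meshes of `1`. [folklore] -/
theorem ib_bounds : 1 - 2 * δ < δ * (ib δ : ℝ) ∧ δ * (ib δ : ℝ) ≤ 1 - δ := by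
  have h1 : ((⌊1 / δ⌋ : ℤ) : ℝ) ≤ 1 / δ := Int.floor_le _
  have h2 : 1 / δ < ((⌊1 / δ⌋ : ℤ) : ℝ) + 1 := Int.lt_floor_add_one _
  have hcast : (ib δ : ℝ) = ((⌊1 / δ⌋ : ℤ) : ℝ) - 1 := by simp [ib]
  rw [hcast]
  have e1 : δ * (((⌊1 / δ⌋ : ℤ) : ℝ) - 1) = δ * ((⌊1 / δ⌋ : ℤ) : ℝ) - δ := by ring
  rw [e1]
  have h1' : δ * ((⌊1 / δ⌋ : ℤ) : ℝ) ≤ δ * (1 / δ) := mul_le_mul_of_nonneg_left h1 hδ.le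
  have h2' : δ * (1 / δ) < δ * (((⌊1 / δ⌋ : ℤ) : ℝ) + 1) := mul_lt_mul_of_pos_left h2 hδ
  rw [mul_one_div_cancel hδ.ne'] at h1' h2'
  constructor <;> linarith

omit h0 in
/-- The ordinate of `b_δ` is within one mesh of the bottom of its column. [folklore] -/
theorem jb_bounds :
    ctr (δ * ib δ) - sl * (δ * ib δ) < δ * (jb δ : ℝ) ∧
      δ * (jb δ : ℝ) ≤ ctr (δ * ib δ) - sl * (δ * ib δ) + δ := by
  set c : ℝ := (ctr (δ * ib δ) - sl * (δ * ib δ)) with hc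
  have h1 : ((⌊c / δ⌋ : ℤ) : ℝ) ≤ c / δ := Int.floor_le _
  have h2 : c / δ < ((⌊c / δ⌋ : ℤ) : ℝ) + 1 := Int.lt_floor_add_one _
  have hcast : (jb δ : ℝ) = ((⌊c / δ⌋ : ℤ) : ℝ) + 1 := by simp [jb, hc]
  rw [hcast]
  have h1' : δ * ((⌊c / δ⌋ : ℤ) : ℝ) ≤ δ * (c / δ) := mul_le_mul_of_nonneg_left h1 hδ.le
  have h2' : δ * (c / δ) < δ * (((⌊c / δ⌋ : ℤ) : ℝ) + 1) := mul_lt_mul_of_pos_left h2 hδ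
  rw [mul_div_cancel₀ _ hδ.ne'] at h1' h2'
  constructor <;> linarith

/-- `b_δ` is a mesh vertex. [folklore] -/
theorem bδ_mem : bδ δ ∈ meshVertices forcingDomain.carrier δ := by
  obtain ⟨hi1, hi2⟩ := ib_bounds hδ
  obtain ⟨hj1, hj2⟩ := jb_bounds hδ
  have hs := delta_small hδ h0
  simp only [bδ]
  rw [vec_mem_iff]
  refine ⟨?_, by linarith⟩
  rw [abs_lt]
  simp only [sl] at *
  constructor <;> nlinarith

/-- `b_δ` lies in the room. [folklore] -/
theorem bδ_mem_RS : bδ δ ∈ RS δ (xres δ) := by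
  refine ⟨bδ_mem hδ h0, ?_⟩
  obtain ⟨hi1, -⟩ := ib_bounds hδ
  have := xres_le_quarter δ
  have := delta_small hδ h0
  simp only [bδ, Matrix.cons_val_zero]
  linarith

/-- `a_δ` and `b_δ` are joined in `Ω_δ`. [folklore] -/
theorem reachable_ab : (discreteDomainGraph forcingDomain.carrier δ).Reachable (aδ δ) (bδ δ) :=
  reachable_dd (good_xres hδ h0) (aδ_mem_RS hδ h0) (bδ_mem_RS hδ h0)

omit h0 in
/-- Size of `δ · a_δ`. [folklore] -/
theorem norm_meshPoint_aδ_le : ‖meshPoint δ (aδ δ)‖ ≤ xres δ + δ + Real.sqrt (xres δ + δ) + δ / 2 := by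
  obtain ⟨h1, h2⟩ := icol_bounds hδ
  have hj := abs_jsp hδ (icol δ)
  have hc := abs_ctr_le (δ * icol δ)
  have hsq : Real.sqrt (δ * icol δ) ≤ Real.sqrt (xres δ + δ) := Real.sqrt_le_sqrt h2.le
  simp only [aδ]
  rw [meshPoint_vec]
  refine (Complex.norm_le_abs_re_add_abs_im _).trans ?_
  simp only
  have hre : |δ * (icol δ : ℝ)| ≤ xres δ + δ := by
    rw [abs_of_nonneg (by linarith [xres_pos δ])]; exact h2.le
  have him : |δ * (jsp δ (icol δ) : ℝ)| ≤ Real.sqrt (xres δ + δ) + δ / 2 := by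
    have : |δ * (jsp δ (icol δ) : ℝ)| ≤ |δ * (jsp δ (icol δ) : ℝ) - ctr (δ * icol δ)| + |ctr (δ * icol δ)| := by
      have := abs_add_le (δ * (jsp δ (icol δ) : ℝ) - ctr (δ * icol δ)) (ctr (δ * icol δ))
      rwa [sub_add_cancel] at this
    linarith
  linarith

omit h0 in
/-- Distance of `δ · b_δ` to `b = 1 - i/4`. [folklore] -/
theorem dist_meshPoint_bδ_le :
    dist (meshPoint δ (bδ δ)) vB ≤ 2 * δ + (|ctr (δ * ib δ)| + sl * (2 * δ) + δ) := by
  obtain ⟨hi1, hi2⟩ := ib_bounds hδ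
  obtain ⟨hj1, hj2⟩ := jb_bounds hδ
  simp only [bδ]
  rw [meshPoint_vec, Complex.dist_eq]
  refine (Complex.norm_le_abs_re_add_abs_im _).trans ?_
  simp only [sub_re, sub_im, vB]
  have hre : |δ * (ib δ : ℝ) - 1| ≤ 2 * δ := by rw [abs_le]; constructor <;> linarith
  have him : |δ * (jb δ : ℝ) - -sl| ≤ |ctr (δ * ib δ)| + sl * (2 * δ) + δ := by
    rw [abs_le]
    have hs := sl_pos
    constructor
    · nlinarith [neg_abs_le (ctr (δ * ↑(ib δ)))]
    · nlinarith [le_abs_self (ctr (δ * ↑(ib δ)))]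
  linarith

end Endpoints

/-- **The endpoint approximation of the witness.** [folklore] -/
theorem isEndpointApprox : SAW.IsEndpointApprox forcingDomain aδ bδ := by
  have hpos : ∀ {d : ℝ}, 0 < d → Ioo (0 : ℝ) d ∈ 𝓝[>] (0 : ℝ) := fun hd => Ioo_mem_nhdsGT hd
  refine ⟨?_, ?_, ?_⟩
  · filter_upwards [hpos (dmin_pos 0)] with δ hδ
    exact reachable_ab hδ.1 hδ.2.le
  · rw [forcingDomain_pt_zero, Metric.tendsto_nhds]
    intro ε hε
    set τ : ℝ := min (ε / 8) (ε ^ 2 / 32) with hτ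
    have hτ0 : 0 < τ := lt_min (by positivity) (by positivity)
    obtain ⟨n₀, hn₀⟩ := exists_xlev_lt hτ0
    filter_upwards [hpos (lt_min (lt_min (dmin_pos 0) (dmin_pos n₀)) hτ0)] with δ hδ
    obtain ⟨hδ0, hδ1⟩ := hδ
    have hd0 : δ ≤ dmin 0 := (hδ1.trans_le ((min_le_left _ _).trans (min_le_left _ _))).le
    have hdn : δ ≤ dmin n₀ := (hδ1.trans_le ((min_le_left _ _).trans (min_le_right _ _))).le
    have hδτ : δ < τ := hδ1.trans_le (min_le_right _ _)
    have hx : xres δ ≤ xlev n₀ := xres_le hδ0 hdn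
    have hbound := norm_meshPoint_aδ_le hδ0
    rw [dist_zero_right]
    have h1 : xres δ + δ < 2 * τ := by linarith
    have h2 : Real.sqrt (xres δ + δ) < ε / 4 := by
      rw [Real.sqrt_lt' (by positivity)]
      have : 2 * τ ≤ ε ^ 2 / 16 := by rw [hτ]; linarith [min_le_right (ε / 8) (ε ^ 2 / 32)]
      linarith
    have h3 : 2 * τ ≤ ε / 4 := by rw [hτ]; linarith [min_le_left (ε / 8) (ε ^ 2 / 32)]
    linarith
  · rw [forcingDomain_pt_one, Metric.tendsto_nhds]
    intro ε hε
    obtain ⟨η, hη, hcont⟩ := Metric.continuousAt_iff.1 (continuous_ctr.continuousAt (x := (1 : ℝ))) (ε / 2)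
      (by positivity)
    filter_upwards [hpos (lt_min (dmin_pos 0) (lt_min (half_pos hη) (show 0 < ε / 8 by positivity)))]
      with δ hδ
    obtain ⟨hδ0, hδ1⟩ := hδ
    have hd0 : δ ≤ dmin 0 := (hδ1.trans_le (min_le_left _ _)).le
    have hδη : δ < η / 2 := hδ1.trans_le ((min_le_right _ _).trans (min_le_left _ _))
    have hδε : δ < ε / 8 := hδ1.trans_le ((min_le_right _ _).trans (min_le_right _ _))
    have hbound := dist_meshPoint_bδ_le hδ0
    obtain ⟨hi1, hi2⟩ := ib_bounds hδ0
    have hc : |ctr (δ * ib δ)| < ε / 2 := by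
      have := hcont (x := δ * ib δ) (by rw [Real.dist_eq, abs_lt]; constructor <;> linarith)
      rwa [Real.dist_eq, ctr_one, sub_zero] at this
    have hs : sl * (2 * δ) < ε / 8 := by simp only [sl]; linarith
    linarith


/-! ## F.1 Chains of crossing times by the intermediate value theorem -/

/-- A continuous real function on `[0,1]` starting below `u 0` and ending above every `u j`
passes the increasing levels `u 0 < u 1 < ⋯ < u m` at increasing times. [folklore] -/
theorem exists_chain {f : unitInterval → ℝ} (hf : Continuous f) (u : ℕ → ℝ) :
    ∀ m : ℕ, (∀ j < m, u j < u (j + 1)) → f 0 < u 0 → (∀ j ≤ m, u j < f 1) →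
      ∃ t : ℕ → unitInterval, (∀ j ≤ m, f (t j) = u j) ∧ ∀ j < m, t j < t (j + 1)
  | 0, _, h0, h1 => by
    have hmem : u 0 ∈ Icc (f 0) (f 1) := ⟨h0.le, (h1 0 le_rfl).le⟩
    obtain ⟨t₀, -, ht₀⟩ := intermediate_value_Icc (zero_le_one (α := unitInterval)) hf.continuousOn hmem
    exact ⟨fun _ => t₀, fun j hj => by rw [Nat.le_zero.1 hj]; exact ht₀, fun j hj => absurd hj (Nat.not_lt_zero _)⟩
  | m + 1, hmono, h0, h1 => by
    obtain ⟨t, ht, hlt⟩ := exists_chain hf u m (fun j hj => hmono j (by omega)) h0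
      (fun j hj => h1 j (by omega))
    have hm : f (t m) = u m := ht m le_rfl
    have hmem : u (m + 1) ∈ Icc (f (t m)) (f 1) :=
      ⟨by rw [hm]; exact (hmono m (by omega)).le, (h1 (m + 1) le_rfl).le⟩
    have hle : t m ≤ 1 := (t m).2.2
    obtain ⟨t', ht'mem, ht'⟩ := intermediate_value_Icc hle hf.continuousOn hmem
    have hlt' : t m < t' := by
      refine lt_of_le_of_ne ht'mem.1 fun h => ?_
      rw [← h, hm] at ht'
      exact (hmono m (by omega)).ne ht'
    refine ⟨fun j => if j ≤ m then t j else t', fun j hj => ?_, fun j hj => ?_⟩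
    · by_cases hjm : j ≤ m
      · simp only [if_pos hjm]; exact ht j hjm
      · have : j = m + 1 := by omega
        simp only [if_neg hjm]; rw [this]; exact ht'
    · by_cases hjm : j < m
      · simp only [if_pos hjm.le, if_pos (Nat.succ_le_of_lt hjm)]; exact hlt j hjm
      · have hj' : j = m := by omega
        subst hj'
        simp only [if_pos le_rfl, if_neg (Nat.lt_irrefl _ ∘ Nat.lt_of_succ_le)]
        exact hlt'

/-- Consecutive strict increase gives strict increase. [folklore] -/
theorem chain_lt {t : ℕ → unitInterval} {m : ℕ} (h : ∀ j < m, t j < t (j + 1)) {a : ℕ} :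
    ∀ {b : ℕ}, a < b → b ≤ m → t a < t b
  | 0, hab, _ => absurd hab (Nat.not_lt_zero _)
  | b + 1, hab, hb => by
    rcases Nat.lt_succ_iff_lt_or_eq.1 hab with hlt | rfl
    · exact (chain_lt h hlt (by omega)).trans (h b (by omega))
    · exact h a (by omega)

/-! ## F.2 The crossing abscissae -/

/-- The crossing abscissae `u_j = 2 / ((2L+1)² + 4k − 2j)`, `j = 0, …, 2k`: at even `j` the centre
line is at its TOP `+√u_j`, at odd `j` at its BOTTOM `−√u_j`. [folklore] -/
def useq (k L : ℕ) (j : ℕ) : ℝ := 2 / ((2 * L + 1 : ℝ) ^ 2 + 4 * k - 2 * j)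

/-- Denominators of the crossing abscissae are positive. [folklore] -/
theorem useq_den_pos (k L : ℕ) {j : ℕ} (hj : j ≤ 2 * k) : 0 < (2 * L + 1 : ℝ) ^ 2 + 4 * k - 2 * j := by
  have : (2 * j : ℝ) ≤ 4 * k := by exact_mod_cast (by omega : 2 * j ≤ 4 * k)
  have hL : (0 : ℝ) ≤ L := Nat.cast_nonneg L
  nlinarith

/-- Crossing abscissae are positive. [folklore] -/
theorem useq_pos (k L : ℕ) {j : ℕ} (hj : j ≤ 2 * k) : 0 < useq k L j :=
  div_pos two_pos (useq_den_pos k L hj)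

/-- Crossing abscissae increase strictly. [folklore] -/
theorem useq_lt_succ (k L : ℕ) {j : ℕ} (hj : j < 2 * k) : useq k L j < useq k L (j + 1) := by
  unfold useq
  have h1 := useq_den_pos k L (Nat.succ_le_of_lt hj)
  have h2 := useq_den_pos k L hj.le
  apply div_lt_div_of_pos_left two_pos h1
  push_cast; linarith

/-- Crossing abscissae increase. [folklore] -/
theorem useq_mono (k L : ℕ) {i j : ℕ} (hij : i ≤ j) (hj : j ≤ 2 * k) : useq k L i ≤ useq k L j := by
  unfold useq
  have h1 := useq_den_pos k L hj
  apply div_le_div_of_nonneg_left two_pos.le h1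
  have : (i : ℝ) ≤ j := by exact_mod_cast hij
  linarith

/-- The first crossing abscissa. [folklore] -/
theorem useq_zero (k L : ℕ) : useq k L 0 = 2 / ((2 * L + 1 : ℝ) ^ 2 + 4 * k) := by
  simp [useq]

/-- The last crossing abscissa. [folklore] -/
theorem useq_top (k L : ℕ) : useq k L (2 * k) = 2 / (2 * L + 1 : ℝ) ^ 2 := by
  unfold useq; congr 1; push_cast; ring

/-- At an even abscissa the centre line is at its top. [folklore] -/
theorem ctr_useq_even (k L m : ℕ) (hm : m ≤ k) : ctr (useq k L (2 * m)) = Real.sqrt (useq k L (2 * m)) := by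
  have hden := useq_den_pos k L (j := 2 * m) (by omega)
  have hN : (2 * L + 1 : ℝ) ^ 2 + 4 * k - 2 * ((2 * m : ℕ) : ℝ) = 4 * ((L ^ 2 + L + (k - m) : ℕ) : ℝ) + 1 := by
    push_cast [Nat.cast_sub hm]; ring
  have harg : π / useq k L (2 * m) = π / 2 + ((L ^ 2 + L + (k - m) : ℕ) : ℝ) * (2 * π) := by
    unfold useq
    rw [hN]
    field_simp
    ring
  rw [ctr, harg, Real.sin_add_nat_mul_two_pi, Real.sin_pi_div_two, mul_one]

/-- At an odd abscissa the centre line is at its bottom. [folklore] -/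
theorem ctr_useq_odd (k L m : ℕ) (hm : m < k) : ctr (useq k L (2 * m + 1)) = -Real.sqrt (useq k L (2 * m + 1)) := by
  have hden := useq_den_pos k L (j := 2 * m + 1) (by omega)
  have hN : (2 * L + 1 : ℝ) ^ 2 + 4 * k - 2 * ((2 * m + 1 : ℕ) : ℝ) = 4 * ((L ^ 2 + L + (k - m) : ℕ) : ℝ) - 1 := by
    push_cast [Nat.cast_sub hm.le]; ring
  have harg : π / useq k L (2 * m + 1) = -(π / 2) + ((L ^ 2 + L + (k - m) : ℕ) : ℝ) * (2 * π) := by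
    unfold useq
    rw [hN]
    field_simp
    ring
  rw [ctr, harg, Real.sin_add_nat_mul_two_pi, Real.sin_neg, Real.sin_pi_div_two, mul_neg, mul_one]

end Summit.CriticalPhenomena.SAWScalingLimit.Theorems.ShellCrossingBound.Negative.Forcing
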